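import Literature.NumberTheory.Sieve.SmoothParityMajorPointTriple
import Literature.NumberTheory.Sieve.SmoothParityMajorArcsTools
import HarnessLib

/-!
# Parity-class friable ternary counts: the major arcs

Topic `Literature/NumberTheory/Sieve`, namespace `Literature.NumberTheory.Sieve.SmoothArcs`; a PROVED file, the
MAJOR-ARC part of the zeroth-order circle method for `y`-friable solutions of `d₁n₁ + σd₂n₂ = n₃`, `n₁, n₂` odd
(`SmoothParityTernary`; [Harper2016, §5], [LagariasSoundararajan2012]).  Notation: `α = α(x,y)`,
`𝓜 = x^α ζ(α,y)/√(2πφ₂(α,y))`, `X_i = x/e_i`, `Mv_i = e_i^{−α}𝓜`, `W`-class profiles `c_i`, `S_i = Σ_ℓ‖c_{i,ℓ}‖(1+|ℓ|)`;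
`V₁, V₂ = classProfileSum X_i y 2 1 c_i` (odd classes), `V₃ = classProfileSum X₃ y 1 0 c₃` (free); `N₀ > d₁X₁ + d₂X₂ + X₃`
sample points, `(d₁, N₀) = 1`; level `R`, radius `ρ = 96R/x`; the MAJOR POINTS are the `r < N₀` with `‖r/N₀ − a/k‖ ≤ ρ`
for some `1 ≤ k ≤ R`, `a < k`, `(k,a) = 1` (`‖·‖ = distInt`: the arc at `0/1` is the full neighbourhood of `0 ≡ 1`).
`parity_major_arcs`: under the pointwise window hypothesis (hW) at precision `η` (scalings `e' ≤ E`, frequencies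
`|λ| ≤ Λ`, `Λ ≥ 192R` decoupled from `R`, `Λ ≤ X_i`) and the character-sum currency (hF),
`‖Σ_{r major} V₁(d₁r/N₀)V₂(σd₂r/N₀)V̄₃(r/N₀) − N₀·𝔖·parityModelCount‖ ≤ ERR` with the explicit `ERR` of the statement:
`(331η ΠMv_iS_i·LAT + 100 ΠMv_iS_i·OFF + 12(ρN₀+1)C₂)·𝓗₃(R) + 12(ρN₀+1)C₁·𝓗⁺(R) + (tail of 𝔖 beyond R)·N₀ΠMv_iS_i/X₃`
(`LAT`: two decaying factors along an arc; `OFF`: off-arc model tail with the `1/d₁`-resonances; `C₁, C₂`: flat errors —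
model comparison `(1+Λ)/X_i`, transfer tail `1/Λ³`, GRH `X_i^{1/2+ε₀}`; `𝓗₃(R) = ΣΣ Hc₁Hc₂Hc₃` and
`𝓗⁺(R) = ΣΣ (1+Hc₁)(1+Hc₂)(1+Hc₃)` over `k ≤ R`, `(k,a) = 1`, of the cancelling majorants `classLocalHc`; bounding these two
arithmetic sums is NOT done here).  Proof: `sum_filter_major_eq_sum_arcs`, `parity_major_point` summed over each arc
(`norm_arc_sum_sub_le`), `parityModel_circle` with the shift `−a/k` minus the off-arc tail (`norm_arc_sum_sub_total_le`,
`norm_modelK_le`), `Σ_{(k,a)=1}LF₁LF₂L̄F₃ = paritySingTerm k`, `norm_paritySingSeries_sub_sum_le`.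

## References

* A. J. Harper, Compositio Math. 152 (2016), §2.2, §5 [Harper2016].
* J. C. Lagarias, K. Soundararajan, Proc. LMS 104 (2012) [LagariasSoundararajan2012].
-/

noncomputable section

open Finset Real Complex
open scoped FourierTransform

namespace Literature.NumberTheory.Sieve

namespace SmoothArcs

open TwistedWeight Vinogradov
open scoped Classical

/-! ### The major arcs -/

set_option maxHeartbeats 1600000 in
/-- **THE MAJOR ARCS of the parity-class friable ternary count** (notation, hypotheses and the explicit `ERR` in the
module docstring): `‖Σ_{r major} V₁(d₁r/N₀)V₂(σd₂r/N₀)V̄₃(r/N₀) − N₀·𝔖·parityModelCount‖ ≤ ERR`.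
[cite: Harper2016, §5] [cite: LagariasSoundararajan2012, Thm 1.3 (shape)] -/
theorem parity_major_arcs {x : ℝ} {y : ℕ} (hx : 1 < x) (hy : 2 ≤ y) (hα : 13 / 15 < saddlePoint x y)
    (hα1 : saddlePoint x y ≤ 1)
    {Λ η E ε₀ C_F : ℝ} (hΛ : 0 < Λ) (hη0 : 0 ≤ η) (hη1 : η ≤ 1) (hε₀ : 0 < ε₀) (hC : 0 ≤ C_F)
    (hW : ∀ e' : ℕ, 1 ≤ e' → (e' : ℝ) ≤ E → ∀ lam : ℝ, |lam| ≤ Λ →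
      ‖(∑ n ∈ Nat.smoothNumbersUpTo ⌊x / e'⌋₊ (y + 1), twistWeight lam (n / (x / e'))) -
          ((((e' : ℝ) ^ (-saddlePoint x y) * (x ^ saddlePoint x y * smoothZeta (saddlePoint x y) y /
              Real.sqrt (2 * Real.pi * saddlePhi₂ (saddlePoint x y) y)) : ℝ)) : ℂ) * twistMellin lam (saddlePoint x y)‖ ≤
        (e' : ℝ) ^ (-saddlePoint x y) * (η * (x ^ saddlePoint x y * smoothZeta (saddlePoint x y) y /
          Real.sqrt (2 * Real.pi * saddlePhi₂ (saddlePoint x y) y)) / (1 + |lam|)))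
    (hF : ∀ (q : ℕ) (χ : DirichletCharacter ℂ q), q ≠ 0 → χ ≠ 1 → ∀ (y : ℕ) (X lam : ℝ), 1 ≤ X →
      ‖∑ n ∈ Nat.smoothNumbersUpTo ⌊X⌋₊ (y + 1), χ (n : ZMod q) * twistWeight lam (n / X)‖ ≤
        C_F * (1 + |lam|) ^ 3 * X ^ (1 / 2 + ε₀) * (q : ℝ) ^ ε₀)
    {e₁ e₂ e₃ d₁ d₂ : ℕ} {σ : ℤ} (hσ : σ = 1 ∨ σ = -1) (he₁ : 1 ≤ e₁) (he₂ : 1 ≤ e₂) (he₃ : 1 ≤ e₃)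
    (hex₁ : (e₁ : ℝ) ≤ x) (hex₂ : (e₂ : ℝ) ≤ x) (hex₃ : (e₃ : ℝ) ≤ x)
    (hΛ₁ : Λ ≤ x / e₁) (hΛ₂ : Λ ≤ x / e₂) (hΛ₃ : Λ ≤ x / e₃)
    (hd₁0 : d₁ ≠ 0) (hd₁e : Even d₁) (hd₂o : Odd d₂)
    (hd₁ : (d₁ : ℝ) * (x / e₁) ≤ x) (hd₂ : (d₂ : ℝ) * (x / e₂) ≤ x)
    {N₀ : ℕ} (hN : (d₁ : ℝ) * (x / e₁) + (d₂ : ℝ) * (x / e₂) + x / e₃ < N₀) (hcop : Nat.Coprime d₁ N₀)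
    {R : ℕ} (hR2 : 2 ≤ R) (hRy : R ≤ y) (hRx : 400 * (R : ℝ) ^ 3 < x) (hxRN : x ≤ 96 * R * N₀)
    (hΛR : 192 * (R : ℝ) ≤ Λ)
    (hE₁ : ((e₁ * (2 * R) ^ 2 : ℕ) : ℝ) ≤ E) (hE₂ : ((e₂ * (2 * R) ^ 2 : ℕ) : ℝ) ≤ E) (hE₃ : ((e₃ * R ^ 2 : ℕ) : ℝ) ≤ E)
    {c₁ c₂ c₃ : ℤ → ℂ} (hc₁ : Summable (fun ℓ : ℤ => ‖c₁ ℓ‖ * (1 + |(ℓ : ℝ)|) ^ 3))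
    (hc₂ : Summable (fun ℓ : ℤ => ‖c₂ ℓ‖ * (1 + |(ℓ : ℝ)|) ^ 3))
    (hc₃ : Summable (fun ℓ : ℤ => ‖c₃ ℓ‖ * (1 + |(ℓ : ℝ)|) ^ 3)) :
    ‖(∑ r ∈ (Finset.range N₀).filter (fun r : ℕ => ∃ k : ℕ, 1 ≤ k ∧ k ≤ R ∧ ∃ a : ℕ, a < k ∧ Nat.Coprime k a ∧
          distInt ((r : ℝ) / N₀ - (a : ℝ) / k) ≤ 96 * R / x),
        classProfileSum (x / e₁) y 2 1 c₁ ((d₁ : ℝ) * ((r : ℝ) / N₀)) *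
          classProfileSum (x / e₂) y 2 1 c₂ ((σ : ℝ) * d₂ * ((r : ℝ) / N₀)) *
          starRingEnd ℂ (classProfileSum (x / e₃) y 1 0 c₃ ((r : ℝ) / N₀))) -
        (N₀ : ℂ) * paritySingSeries (saddlePoint x y) σ d₁ d₂ *
          parityModelCount σ d₁ d₂ (x / e₁) (x / e₂) (x / e₃) ((e₁ : ℝ) ^ (-saddlePoint x y) * (x ^ saddlePoint x y * smoothZeta (saddlePoint x y) y /
            Real.sqrt (2 * Real.pi * saddlePhi₂ (saddlePoint x y) y))) ((e₂ : ℝ) ^ (-saddlePoint x y) * (x ^ saddlePoint x y * smoothZeta (saddlePoint x y) y /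
            Real.sqrt (2 * Real.pi * saddlePhi₂ (saddlePoint x y) y))) ((e₃ : ℝ) ^ (-saddlePoint x y) * (x ^ saddlePoint x y * smoothZeta (saddlePoint x y) y /
            Real.sqrt (2 * Real.pi * saddlePhi₂ (saddlePoint x y) y))) (saddlePoint x y) c₁ c₂ c₃‖ ≤
      (331 * η * ((((e₁ : ℝ) ^ (-saddlePoint x y) * (x ^ saddlePoint x y * smoothZeta (saddlePoint x y) y /
            Real.sqrt (2 * Real.pi * saddlePhi₂ (saddlePoint x y) y))) * (∑' ℓ : ℤ, ‖c₁ ℓ‖ * (1 + |(ℓ : ℝ)|))) *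
            (((e₂ : ℝ) ^ (-saddlePoint x y) * (x ^ saddlePoint x y * smoothZeta (saddlePoint x y) y /
            Real.sqrt (2 * Real.pi * saddlePhi₂ (saddlePoint x y) y))) * (∑' ℓ : ℤ, ‖c₂ ℓ‖ * (1 + |(ℓ : ℝ)|))) * (((e₃ : ℝ) ^ (-saddlePoint x y) * (x ^ saddlePoint x y * smoothZeta (saddlePoint x y) y /
            Real.sqrt (2 * Real.pi * saddlePhi₂ (saddlePoint x y) y))) * (∑' ℓ : ℤ, ‖c₃ ℓ‖ * (1 + |(ℓ : ℝ)|)))) *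
            (4 * (1 + (N₀ : ℝ) / (x / e₃) * (3 + |Real.log ((x / e₃) / N₀)| + |Real.log ((d₁ : ℝ) * (x / e₁) / N₀)|))) +
          100 * ((((e₁ : ℝ) ^ (-saddlePoint x y) * (x ^ saddlePoint x y * smoothZeta (saddlePoint x y) y /
            Real.sqrt (2 * Real.pi * saddlePhi₂ (saddlePoint x y) y))) * (∑' ℓ : ℤ, ‖c₁ ℓ‖ * (1 + |(ℓ : ℝ)|))) *
            (((e₂ : ℝ) ^ (-saddlePoint x y) * (x ^ saddlePoint x y * smoothZeta (saddlePoint x y) y /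
            Real.sqrt (2 * Real.pi * saddlePhi₂ (saddlePoint x y) y))) * (∑' ℓ : ℤ, ‖c₂ ℓ‖ * (1 + |(ℓ : ℝ)|))) * (((e₃ : ℝ) ^ (-saddlePoint x y) * (x ^ saddlePoint x y * smoothZeta (saddlePoint x y) y /
            Real.sqrt (2 * Real.pi * saddlePhi₂ (saddlePoint x y) y))) * (∑' ℓ : ℤ, ‖c₃ ℓ‖ * (1 + |(ℓ : ℝ)|)))) *
            (16 * N₀ / ((x / e₃) * ((d₁ : ℝ) * (x / e₁)) * (96 * R / x)) +
              2 * d₁ / (x / e₃) * (4 * (1 + (N₀ : ℝ) / (x / e₁) * (1 + Real.log N₀)))) +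
          12 * (96 * R / x * N₀ + 1) * ((((e₁ : ℝ) ^ (-saddlePoint x y) * (x ^ saddlePoint x y * smoothZeta (saddlePoint x y) y /
            Real.sqrt (2 * Real.pi * saddlePhi₂ (saddlePoint x y) y))) * (11 * (∑' ℓ : ℤ, ‖c₁ ℓ‖ * (1 + |(ℓ : ℝ)|)) + (12 * (1 + Λ) * (∑' ℓ : ℤ, ‖c₁ ℓ‖ * (1 + |(ℓ : ℝ)|)) / (x / e₁) + 16 * profileNorm c₁ / Λ ^ 3))) * (((e₂ : ℝ) ^ (-saddlePoint x y) * (x ^ saddlePoint x y * smoothZeta (saddlePoint x y) y /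
            Real.sqrt (2 * Real.pi * saddlePhi₂ (saddlePoint x y) y))) * (11 * (∑' ℓ : ℤ, ‖c₂ ℓ‖ * (1 + |(ℓ : ℝ)|)) + (12 * (1 + Λ) * (∑' ℓ : ℤ, ‖c₂ ℓ‖ * (1 + |(ℓ : ℝ)|)) / (x / e₂) + 16 * profileNorm c₂ / Λ ^ 3))) * (((e₃ : ℝ) ^ (-saddlePoint x y) * (x ^ saddlePoint x y * smoothZeta (saddlePoint x y) y /
            Real.sqrt (2 * Real.pi * saddlePhi₂ (saddlePoint x y) y))) * (11 * (∑' ℓ : ℤ, ‖c₃ ℓ‖ * (1 + |(ℓ : ℝ)|)) + (12 * (1 + Λ) * (∑' ℓ : ℤ, ‖c₃ ℓ‖ * (1 + |(ℓ : ℝ)|)) / (x / e₃) + 16 * profileNorm c₃ / Λ ^ 3))) - (11 * (((e₁ : ℝ) ^ (-saddlePoint x y) * (x ^ saddlePoint x y * smoothZeta (saddlePoint x y) y /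
            Real.sqrt (2 * Real.pi * saddlePhi₂ (saddlePoint x y) y))) * (∑' ℓ : ℤ, ‖c₁ ℓ‖ * (1 + |(ℓ : ℝ)|)))) * (11 * (((e₂ : ℝ) ^ (-saddlePoint x y) * (x ^ saddlePoint x y * smoothZeta (saddlePoint x y) y /
            Real.sqrt (2 * Real.pi * saddlePhi₂ (saddlePoint x y) y))) * (∑' ℓ : ℤ, ‖c₂ ℓ‖ * (1 + |(ℓ : ℝ)|)))) * (11 * (((e₃ : ℝ) ^ (-saddlePoint x y) * (x ^ saddlePoint x y * smoothZeta (saddlePoint x y) y /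
            Real.sqrt (2 * Real.pi * saddlePhi₂ (saddlePoint x y) y))) * (∑' ℓ : ℤ, ‖c₃ ℓ‖ * (1 + |(ℓ : ℝ)|)))))) *
          (∑ k ∈ Icc 1 R, ∑ a ∈ (Finset.range k).filter (Nat.Coprime k),
            classLocalHc (saddlePoint x y) 2 1 k (d₁ * a) * classLocalHc (saddlePoint x y) 2 1 k (σ * (d₂ * a)) *
              classLocalHc (saddlePoint x y) 1 0 k a) +
        12 * (96 * R / x * N₀ + 1) * (((((e₁ : ℝ) ^ (-saddlePoint x y) * (x ^ saddlePoint x y * smoothZeta (saddlePoint x y) y /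
            Real.sqrt (2 * Real.pi * saddlePhi₂ (saddlePoint x y) y))) * (11 * (∑' ℓ : ℤ, ‖c₁ ℓ‖ * (1 + |(ℓ : ℝ)|)) + (12 * (1 + Λ) * (∑' ℓ : ℤ, ‖c₁ ℓ‖ * (1 + |(ℓ : ℝ)|)) / (x / e₁) + 16 * profileNorm c₁ / Λ ^ 3))) + (((2 * R : ℝ) * C_F * (x / e₁) ^ (1 / 2 + ε₀) * (2 * R : ℝ) ^ ε₀ * (1 + Λ) ^ 3 +
            16 * ((Nat.smoothNumbersUpTo ⌊x / e₁⌋₊ (y + 1)).card : ℝ) / Λ ^ 3) * profileNorm c₁)) * ((((e₂ : ℝ) ^ (-saddlePoint x y) * (x ^ saddlePoint x y * smoothZeta (saddlePoint x y) y /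
            Real.sqrt (2 * Real.pi * saddlePhi₂ (saddlePoint x y) y))) * (11 * (∑' ℓ : ℤ, ‖c₂ ℓ‖ * (1 + |(ℓ : ℝ)|)) + (12 * (1 + Λ) * (∑' ℓ : ℤ, ‖c₂ ℓ‖ * (1 + |(ℓ : ℝ)|)) / (x / e₂) + 16 * profileNorm c₂ / Λ ^ 3))) + (((2 * R : ℝ) * C_F * (x / e₂) ^ (1 / 2 + ε₀) * (2 * R : ℝ) ^ ε₀ * (1 + Λ) ^ 3 +
            16 * ((Nat.smoothNumbersUpTo ⌊x / e₂⌋₊ (y + 1)).card : ℝ) / Λ ^ 3) * profileNorm c₂)) * ((((e₃ : ℝ) ^ (-saddlePoint x y) * (x ^ saddlePoint x y * smoothZeta (saddlePoint x y) y /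
            Real.sqrt (2 * Real.pi * saddlePhi₂ (saddlePoint x y) y))) * (11 * (∑' ℓ : ℤ, ‖c₃ ℓ‖ * (1 + |(ℓ : ℝ)|)) + (12 * (1 + Λ) * (∑' ℓ : ℤ, ‖c₃ ℓ‖ * (1 + |(ℓ : ℝ)|)) / (x / e₃) + 16 * profileNorm c₃ / Λ ^ 3))) + (((2 * R : ℝ) * C_F * (x / e₃) ^ (1 / 2 + ε₀) * (2 * R : ℝ) ^ ε₀ * (1 + Λ) ^ 3 +
            16 * ((Nat.smoothNumbersUpTo ⌊x / e₃⌋₊ (y + 1)).card : ℝ) / Λ ^ 3) * profileNorm c₃)) - (((e₁ : ℝ) ^ (-saddlePoint x y) * (x ^ saddlePoint x y * smoothZeta (saddlePoint x y) y /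
            Real.sqrt (2 * Real.pi * saddlePhi₂ (saddlePoint x y) y))) * (11 * (∑' ℓ : ℤ, ‖c₁ ℓ‖ * (1 + |(ℓ : ℝ)|)) + (12 * (1 + Λ) * (∑' ℓ : ℤ, ‖c₁ ℓ‖ * (1 + |(ℓ : ℝ)|)) / (x / e₁) + 16 * profileNorm c₁ / Λ ^ 3))) * (((e₂ : ℝ) ^ (-saddlePoint x y) * (x ^ saddlePoint x y * smoothZeta (saddlePoint x y) y /
            Real.sqrt (2 * Real.pi * saddlePhi₂ (saddlePoint x y) y))) * (11 * (∑' ℓ : ℤ, ‖c₂ ℓ‖ * (1 + |(ℓ : ℝ)|)) + (12 * (1 + Λ) * (∑' ℓ : ℤ, ‖c₂ ℓ‖ * (1 + |(ℓ : ℝ)|)) / (x / e₂) + 16 * profileNorm c₂ / Λ ^ 3))) * (((e₃ : ℝ) ^ (-saddlePoint x y) * (x ^ saddlePoint x y * smoothZeta (saddlePoint x y) y /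
            Real.sqrt (2 * Real.pi * saddlePhi₂ (saddlePoint x y) y))) * (11 * (∑' ℓ : ℤ, ‖c₃ ℓ‖ * (1 + |(ℓ : ℝ)|)) + (12 * (1 + Λ) * (∑' ℓ : ℤ, ‖c₃ ℓ‖ * (1 + |(ℓ : ℝ)|)) / (x / e₃) + 16 * profileNorm c₃ / Λ ^ 3)))) *
          (∑ k ∈ Icc 1 R, ∑ a ∈ (Finset.range k).filter (Nat.Coprime k),
            (1 + classLocalHc (saddlePoint x y) 2 1 k (d₁ * a)) * (1 + classLocalHc (saddlePoint x y) 2 1 k (σ * (d₂ * a))) *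
              (1 + classLocalHc (saddlePoint x y) 1 0 k a)) +
        3 * ((d₁ * d₂ : ℕ) : ℝ) ^ saddlePoint x y *
            Real.exp (2420 * (1 - saddlePoint x y) / (3 * saddlePoint x y - 13 / 5 - (3 * saddlePoint x y - 13 / 5) / 2)) *
            ((R + 1 : ℕ) : ℝ) ^ (-((3 * saddlePoint x y - 13 / 5) / 2)) *
          ((N₀ : ℝ) * (((((e₁ : ℝ) ^ (-saddlePoint x y) * (x ^ saddlePoint x y * smoothZeta (saddlePoint x y) y /
            Real.sqrt (2 * Real.pi * saddlePhi₂ (saddlePoint x y) y))) * (∑' ℓ : ℤ, ‖c₁ ℓ‖ * (1 + |(ℓ : ℝ)|))) *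
            (((e₂ : ℝ) ^ (-saddlePoint x y) * (x ^ saddlePoint x y * smoothZeta (saddlePoint x y) y /
            Real.sqrt (2 * Real.pi * saddlePhi₂ (saddlePoint x y) y))) * (∑' ℓ : ℤ, ‖c₂ ℓ‖ * (1 + |(ℓ : ℝ)|))) * (((e₃ : ℝ) ^ (-saddlePoint x y) * (x ^ saddlePoint x y * smoothZeta (saddlePoint x y) y /
            Real.sqrt (2 * Real.pi * saddlePhi₂ (saddlePoint x y) y))) * (∑' ℓ : ℤ, ‖c₃ ℓ‖ * (1 + |(ℓ : ℝ)|)))) / (x / e₃))) := by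
  have hx0 : 0 < x := by linarith
  set α : ℝ := saddlePoint x y with hα'
  have hα0 : 0 < α := saddlePoint_pos hx hy
  obtain ⟨he₁0, he₂0, he₃0⟩ : (0 : ℝ) < e₁ ∧ (0 : ℝ) < e₂ ∧ (0 : ℝ) < e₃ :=
    ⟨by exact_mod_cast he₁, by exact_mod_cast he₂, by exact_mod_cast he₃⟩
  set X₁ : ℝ := x / e₁ with hX₁'
  set X₂ : ℝ := x / e₂ with hX₂'
  set X₃ : ℝ := x / e₃ with hX₃'
  obtain ⟨hX₁, hX₂, hX₃⟩ : 1 ≤ X₁ ∧ 1 ≤ X₂ ∧ 1 ≤ X₃ := ⟨by rw [hX₁', le_div_iff₀ he₁0, one_mul]; exact hex₁,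
    by rw [hX₂', le_div_iff₀ he₂0, one_mul]; exact hex₂, by rw [hX₃', le_div_iff₀ he₃0, one_mul]; exact hex₃⟩
  obtain ⟨hX₁0, hX₂0, hX₃0⟩ : 0 < X₁ ∧ 0 < X₂ ∧ 0 < X₃ := ⟨by linarith, by linarith, by linarith⟩
  set M₀ : ℝ := x ^ α * smoothZeta α y / Real.sqrt (2 * Real.pi * saddlePhi₂ α y) with hM₀'
  have hM₀ : 0 ≤ M₀ :=
    div_nonneg (mul_nonneg (Real.rpow_nonneg hx0.le _) (smoothZeta_pos hα0).le) (Real.sqrt_nonneg _)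
  set Mv₁ : ℝ := (e₁ : ℝ) ^ (-α) * M₀ with hMv₁'
  set Mv₂ : ℝ := (e₂ : ℝ) ^ (-α) * M₀ with hMv₂'
  set Mv₃ : ℝ := (e₃ : ℝ) ^ (-α) * M₀ with hMv₃'
  obtain ⟨hMv₁, hMv₂, hMv₃⟩ : 0 ≤ Mv₁ ∧ 0 ≤ Mv₂ ∧ 0 ≤ Mv₃ := ⟨mul_nonneg (Real.rpow_nonneg he₁0.le _) hM₀,
    mul_nonneg (Real.rpow_nonneg he₂0.le _) hM₀, mul_nonneg (Real.rpow_nonneg he₃0.le _) hM₀⟩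
  set S₁ : ℝ := ∑' ℓ : ℤ, ‖c₁ ℓ‖ * (1 + |(ℓ : ℝ)|) with hS₁'
  set S₂ : ℝ := ∑' ℓ : ℤ, ‖c₂ ℓ‖ * (1 + |(ℓ : ℝ)|) with hS₂'
  set S₃ : ℝ := ∑' ℓ : ℤ, ‖c₃ ℓ‖ * (1 + |(ℓ : ℝ)|) with hS₃'
  obtain ⟨hS₁, hS₂, hS₃⟩ : 0 ≤ S₁ ∧ 0 ≤ S₂ ∧ 0 ≤ S₃ :=
    ⟨tsum_nonneg fun ℓ => by positivity, tsum_nonneg fun ℓ => by positivity, tsum_nonneg fun ℓ => by positivity⟩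
  have hR0 : (0 : ℝ) < R := by exact_mod_cast (by omega : 0 < R)
  set ρ : ℝ := 96 * R / x with hρ'
  have hN0r : (0 : ℝ) < N₀ := lt_of_le_of_lt (by positivity) hN
  obtain ⟨hρ0, hN0⟩ : 0 < ρ ∧ 0 < N₀ := ⟨by positivity, by exact_mod_cast hN0r⟩
  have hρN : 1 ≤ ρ * N₀ := by
    rw [hρ', div_mul_eq_mul_div, le_div_iff₀ hx0, one_mul]; linarith
  have hρR : 2 * ρ * (R : ℝ) ^ 2 < 1 := by
    rw [hρ', show 2 * (96 * (R : ℝ) / x) * (R : ℝ) ^ 2 = 192 * (R : ℝ) ^ 3 / x by ring, div_lt_one hx0]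
    nlinarith [pow_nonneg hR0.le 3]
  have hρx : ρ * x = 96 * R := by rw [hρ']; field_simp
  have hd₁1 : 1 ≤ d₁ := Nat.one_le_iff_ne_zero.mpr hd₁0
  have hwrap : d₁ * ⌊X₁⌋₊ + d₂ * ⌊X₂⌋₊ + ⌊X₃⌋₊ < N₀ := by
    have : ((d₁ * ⌊X₁⌋₊ + d₂ * ⌊X₂⌋₊ + ⌊X₃⌋₊ : ℕ) : ℝ) < N₀ := by
      push_cast
      nlinarith [Nat.cast_nonneg (α := ℝ) d₁, Nat.cast_nonneg (α := ℝ) d₂, Nat.floor_le hX₁0.le, Nat.floor_le hX₂0.le,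
        Nat.floor_le hX₃0.le]
    exact_mod_cast this
  set G : ℝ → ℂ := fun θ => classProfileSum X₁ y 2 1 c₁ ((d₁ : ℝ) * θ) *
    classProfileSum X₂ y 2 1 c₂ ((σ : ℝ) * d₂ * θ) * starRingEnd ℂ (classProfileSum X₃ y 1 0 c₃ θ) with hG'
  set K : ℝ → ℂ := fun u => profileModelSum c₁ Mv₁ X₁ α ((d₁ : ℝ) * u) *
    profileModelSum c₂ Mv₂ X₂ α ((σ : ℝ) * d₂ * u) * starRingEnd ℂ (profileModelSum c₃ Mv₃ X₃ α u) with hK'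
  set LFp : ℕ → ℕ → ℂ := fun k a => classLocalFactor α 2 1 k (d₁ * a) * classLocalFactor α 2 1 k (σ * (d₂ * a)) *
    starRingEnd ℂ (classLocalFactor α 1 0 k a) with hLFp'
  set H3 : ℕ → ℕ → ℝ := fun k a => classLocalHc α 2 1 k (d₁ * a) * classLocalHc α 2 1 k (σ * (d₂ * a)) *
    classLocalHc α 1 0 k a with hH3'
  set Hp : ℕ → ℕ → ℝ := fun k a => (1 + classLocalHc α 2 1 k (d₁ * a)) * (1 + classLocalHc α 2 1 k (σ * (d₂ * a))) *
    (1 + classLocalHc α 1 0 k a) with hHp'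
  set MC : ℂ := parityModelCount σ d₁ d₂ X₁ X₂ X₃ Mv₁ Mv₂ Mv₃ α c₁ c₂ c₃ with hMC'
  set LAT : ℝ := 4 * (1 + (N₀ : ℝ) / X₃ * (3 + |Real.log (X₃ / N₀)| + |Real.log ((d₁ : ℝ) * X₁ / N₀)|)) with hLAT'
  set OFF : ℝ := 16 * N₀ / (X₃ * ((d₁ : ℝ) * X₁) * ρ) + 2 * d₁ / X₃ * (4 * (1 + (N₀ : ℝ) / X₁ * (1 + Real.log N₀)))
    with hOFF'
  set P : ℝ := 100 * ((Mv₁ * S₁) * (Mv₂ * S₂) * (Mv₃ * S₃)) with hP'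
  set b₁ : ℝ := Mv₁ * (11 * S₁ + (12 * (1 + Λ) * S₁ / X₁ + 16 * profileNorm c₁ / Λ ^ 3)) with hb₁'
  set b₂ : ℝ := Mv₂ * (11 * S₂ + (12 * (1 + Λ) * S₂ / X₂ + 16 * profileNorm c₂ / Λ ^ 3)) with hb₂'
  set b₃ : ℝ := Mv₃ * (11 * S₃ + (12 * (1 + Λ) * S₃ / X₃ + 16 * profileNorm c₃ / Λ ^ 3)) with hb₃'
  set w₁ : ℝ := ((2 * R : ℝ) * C_F * X₁ ^ (1 / 2 + ε₀) * (2 * R : ℝ) ^ ε₀ * (1 + Λ) ^ 3 +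
    16 * ((Nat.smoothNumbersUpTo ⌊X₁⌋₊ (y + 1)).card : ℝ) / Λ ^ 3) * profileNorm c₁ with hw₁'
  set w₂ : ℝ := ((2 * R : ℝ) * C_F * X₂ ^ (1 / 2 + ε₀) * (2 * R : ℝ) ^ ε₀ * (1 + Λ) ^ 3 +
    16 * ((Nat.smoothNumbersUpTo ⌊X₂⌋₊ (y + 1)).card : ℝ) / Λ ^ 3) * profileNorm c₂ with hw₂'
  set w₃ : ℝ := ((2 * R : ℝ) * C_F * X₃ ^ (1 / 2 + ε₀) * (2 * R : ℝ) ^ ε₀ * (1 + Λ) ^ 3 +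
    16 * ((Nat.smoothNumbersUpTo ⌊X₃⌋₊ (y + 1)).card : ℝ) / Λ ^ 3) * profileNorm c₃ with hw₃'
  set C₁ : ℝ := (b₁ + w₁) * (b₂ + w₂) * (b₃ + w₃) - b₁ * b₂ * b₃ with hC₁'
  set C₂ : ℝ := b₁ * b₂ * b₃ - 11 * (Mv₁ * S₁) * (11 * (Mv₂ * S₂)) * (11 * (Mv₃ * S₃)) with hC₂'
  set TAILB : ℝ := 3 * ((d₁ * d₂ : ℕ) : ℝ) ^ α * Real.exp (2420 * (1 - α) / (3 * α - 13 / 5 - (3 * α - 13 / 5) / 2)) *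
    ((R + 1 : ℕ) : ℝ) ^ (-((3 * α - 13 / 5) / 2)) with hTAILB'
  have hH3nn : ∀ k a : ℕ, 0 ≤ H3 k a := fun k a => mul_nonneg (mul_nonneg (classLocalHc_nonneg α 2 1 k _)
    (classLocalHc_nonneg α 2 1 k _)) (classLocalHc_nonneg α 1 0 k _)
  have hHpnn : ∀ k a : ℕ, 0 ≤ Hp k a := fun k a => mul_nonneg (mul_nonneg (add_nonneg zero_le_one (classLocalHc_nonneg α 2 1 k _))
    (add_nonneg zero_le_one (classLocalHc_nonneg α 2 1 k _))) (add_nonneg zero_le_one (classLocalHc_nonneg α 1 0 k _))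
  have hTAILB0 : 0 ≤ TAILB := by positivity
  clear_value TAILB C₂ C₁ w₃ w₂ w₁ b₃ b₂ b₁ P OFF LAT MC Hp H3 LFp K G ρ S₃ S₂ S₁ Mv₃ Mv₂ Mv₁ M₀ X₃ X₂ X₁ α
  obtain ⟨hpN₁, hpN₂, hpN₃⟩ := And.intro (profileNorm_nonneg c₁) (And.intro (profileNorm_nonneg c₂) (profileNorm_nonneg c₃))
  obtain ⟨hb₁p, hb₂p, hb₃p⟩ : 11 * (Mv₁ * S₁) ≤ b₁ ∧ 11 * (Mv₂ * S₂) ≤ b₂ ∧ 11 * (Mv₃ * S₃) ≤ b₃ :=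
    ⟨by rw [hb₁']; exact eleven_mul_le hMv₁ (by positivity), by rw [hb₂']; exact eleven_mul_le hMv₂ (by positivity),
      by rw [hb₃']; exact eleven_mul_le hMv₃ (by positivity)⟩
  obtain ⟨hb₁0, hb₂0, hb₃0⟩ : 0 ≤ b₁ ∧ 0 ≤ b₂ ∧ 0 ≤ b₃ :=
    ⟨le_trans (by positivity) hb₁p, le_trans (by positivity) hb₂p, le_trans (by positivity) hb₃p⟩
  obtain ⟨hw₁0, hw₂0, hw₃0⟩ : 0 ≤ w₁ ∧ 0 ≤ w₂ ∧ 0 ≤ w₃ :=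
    ⟨by rw [hw₁']; positivity, by rw [hw₂']; positivity, by rw [hw₃']; positivity⟩
  have hC₁0 : 0 ≤ C₁ := by
    rw [hC₁']
    have := prod_three_mono hb₁0 hb₂0 hb₃0 le_rfl le_rfl le_rfl hw₁0 hw₂0 hw₃0
    simp only [add_zero] at this
    linarith
  have hC₂0 : 0 ≤ C₂ := by
    rw [hC₂']
    have := mul_le_mul (mul_le_mul hb₁p hb₂p (by positivity) hb₁0) hb₃p (by positivity) (mul_nonneg hb₁0 hb₂0)
    linarith
  have hd₁r : (1 : ℝ) ≤ d₁ := by exact_mod_cast hd₁1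
  obtain ⟨hP0, hLAT0, hOFF0⟩ : 0 ≤ P ∧ 0 ≤ LAT ∧ 0 ≤ OFF :=
    ⟨by rw [hP']; positivity, by rw [hLAT']; positivity, by rw [hOFF']; positivity⟩
  have hWraw := hW
  rw [hM₀', hα'] at hWraw
  have hα1' : saddlePoint x y ≤ 1 := by rw [← hα']; exact hα1
  obtain ⟨hΛ₁', hΛ₂', hΛ₃'⟩ : Λ ≤ x / e₁ ∧ Λ ≤ x / e₂ ∧ Λ ≤ x / e₃ :=
    ⟨by rw [← hX₁']; exact hΛ₁, by rw [← hX₂']; exact hΛ₂, by rw [← hX₃']; exact hΛ₃⟩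
  obtain ⟨hd₁', hd₂'⟩ : (d₁ : ℝ) * (x / e₁) ≤ x ∧ (d₂ : ℝ) * (x / e₂) ≤ x :=
    ⟨by rw [← hX₁']; exact hd₁, by rw [← hX₂']; exact hd₂⟩
  -- ### Step A: the major points as a disjoint union of arcs (`sum_filter_major_eq_sum_arcs`)
  have hGr : ∀ r : ℕ, classProfileSum X₁ y 2 1 c₁ ((d₁ : ℝ) * ((r : ℝ) / N₀)) *
      classProfileSum X₂ y 2 1 c₂ ((σ : ℝ) * d₂ * ((r : ℝ) / N₀)) * starRingEnd ℂ (classProfileSum X₃ y 1 0 c₃ ((r : ℝ) / N₀)) =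
      G ((r : ℝ) / N₀) := fun r => by simp only [hG']
  simp only [hGr]
  have hA := sum_filter_major_eq_sum_arcs (N₀ := N₀) hρR (fun r => G ((r : ℝ) / N₀))
  beta_reduce at hA; rw [hA]
  -- ### Step B: the estimate on one arc (pointwise estimate summed)
  have harcG : ∀ k ∈ Icc 1 R, ∀ a ∈ (Finset.range k).filter (Nat.Coprime k),
      ‖(∑ r ∈ (Finset.range N₀).filter (fun r : ℕ => distInt ((r : ℝ) / N₀ - (a : ℝ) / k) ≤ ρ), G ((r : ℝ) / N₀)) - LFp k a * ∑ r ∈ (Finset.range N₀).filter (fun r : ℕ => distInt ((r : ℝ) / N₀ - (a : ℝ) / k) ≤ ρ), K ((r : ℝ) / N₀ - (a : ℝ) / k)‖ ≤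
        H3 k a * (331 * η * ((Mv₁ * S₁) * (Mv₂ * S₂) * (Mv₃ * S₃)) * LAT + 12 * (ρ * N₀ + 1) * C₂) +
          Hp k a * (12 * (ρ * N₀ + 1) * C₁) := by
    intro k hk a _
    obtain ⟨hk1, hkR⟩ := Finset.mem_Icc.mp hk
    have hkSm : k ∈ Nat.smoothNumbers (y + 1) := Nat.mem_smoothNumbers_of_lt hk1 (by omega)
    obtain ⟨hk0, hkR'⟩ : (0 : ℝ) < k ∧ (k : ℝ) ≤ R := ⟨by exact_mod_cast hk1, by exact_mod_cast hkR⟩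
    have hEk₁ : ((e₁ * (2 * k) ^ 2 : ℕ) : ℝ) ≤ E :=
      le_trans (by exact_mod_cast Nat.mul_le_mul_left e₁ (Nat.pow_le_pow_left (Nat.mul_le_mul_left 2 hkR) 2)) hE₁
    have hEk₂ : ((e₂ * (2 * k) ^ 2 : ℕ) : ℝ) ≤ E :=
      le_trans (by exact_mod_cast Nat.mul_le_mul_left e₂ (Nat.pow_le_pow_left (Nat.mul_le_mul_left 2 hkR) 2)) hE₂
    have hEk₃ : ((e₃ * k ^ 2 : ℕ) : ℝ) ≤ E :=
      le_trans (by exact_mod_cast Nat.mul_le_mul_left e₃ (Nat.pow_le_pow_left hkR 2)) hE₃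
    set Hc₁ : ℝ := classLocalHc α 2 1 k (d₁ * a) with hHc₁'
    set Hc₂ : ℝ := classLocalHc α 2 1 k (σ * (d₂ * a)) with hHc₂'
    set Hc₃ : ℝ := classLocalHc α 1 0 k a with hHc₃'
    obtain ⟨hHc₁0, hHc₂0, hHc₃0⟩ : 0 ≤ Hc₁ ∧ 0 ≤ Hc₂ ∧ 0 ≤ Hc₃ :=
      ⟨classLocalHc_nonneg α 2 1 k _, classLocalHc_nonneg α 2 1 k _, classLocalHc_nonneg α 1 0 k _⟩
    have hH3ka : H3 k a = Hc₁ * Hc₂ * Hc₃ := by simp only [hH3']; rw [← hHc₁', ← hHc₂', ← hHc₃']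
    have hHpka : Hp k a = (1 + Hc₁) * (1 + Hc₂) * (1 + Hc₃) := by simp only [hHp']; rw [← hHc₁', ← hHc₂', ← hHc₃']
    set wk₁ : ℝ := ((2 * k : ℝ) * C_F * X₁ ^ (1 / 2 + ε₀) * (2 * k : ℝ) ^ ε₀ * (1 + Λ) ^ 3 +
      16 * ((Nat.smoothNumbersUpTo ⌊X₁⌋₊ (y + 1)).card : ℝ) / Λ ^ 3) * profileNorm c₁ with hwk₁'
    set wk₂ : ℝ := ((2 * k : ℝ) * C_F * X₂ ^ (1 / 2 + ε₀) * (2 * k : ℝ) ^ ε₀ * (1 + Λ) ^ 3 +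
      16 * ((Nat.smoothNumbersUpTo ⌊X₂⌋₊ (y + 1)).card : ℝ) / Λ ^ 3) * profileNorm c₂ with hwk₂'
    set wk₃ : ℝ := ((2 * k : ℝ) * C_F * X₃ ^ (1 / 2 + ε₀) * (2 * k : ℝ) ^ ε₀ * (1 + Λ) ^ 3 +
      16 * ((Nat.smoothNumbersUpTo ⌊X₃⌋₊ (y + 1)).card : ℝ) / Λ ^ 3) * profileNorm c₃ with hwk₃'
    set A : ℝ := max X₃ ((d₁ : ℝ) * X₁) with hA'
    set B : ℝ := min X₃ ((d₁ : ℝ) * X₁) with hB'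
    set D : ℝ := 331 * η * (Hc₁ * (Mv₁ * S₁)) * (Hc₂ * (Mv₂ * S₂)) * (Hc₃ * (Mv₃ * S₃)) with hD'
    set Fl : ℝ := 3 * ((1 + Hc₁) * (1 + Hc₂) * (1 + Hc₃) * C₁ + Hc₁ * Hc₂ * Hc₃ * C₂) with hFl'
    clear_value Fl D B A wk₃ wk₂ wk₁ Hc₃ Hc₂ Hc₁
    obtain ⟨hk0', hΛ1⟩ : (0 : ℝ) ≤ k ∧ 0 ≤ 1 + Λ := ⟨hk0.le, by linarith⟩
    have hwk₁ : wk₁ ≤ w₁ := by rw [hwk₁', hw₁']; exact flat_w_mono hk0' hkR' hC (by positivity) hε₀.le hΛ1 hpN₁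
    have hwk₂ : wk₂ ≤ w₂ := by rw [hwk₂', hw₂']; exact flat_w_mono hk0' hkR' hC (by positivity) hε₀.le hΛ1 hpN₂
    have hwk₃ : wk₃ ≤ w₃ := by rw [hwk₃', hw₃']; exact flat_w_mono hk0' hkR' hC (by positivity) hε₀.le hΛ1 hpN₃
    obtain ⟨hwk₁0, hwk₂0, hwk₃0⟩ : 0 ≤ wk₁ ∧ 0 ≤ wk₂ ∧ 0 ≤ wk₃ :=
      ⟨by rw [hwk₁']; positivity, by rw [hwk₂']; positivity, by rw [hwk₃']; positivity⟩
    have hflat : (11 * (Hc₁ * (Mv₁ * S₁)) + (Hc₁ * Mv₁ * (12 * (1 + Λ) * S₁ / X₁ + 16 * profileNorm c₁ / Λ ^ 3) + wk₁)) *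
          (11 * (Hc₂ * (Mv₂ * S₂)) + (Hc₂ * Mv₂ * (12 * (1 + Λ) * S₂ / X₂ + 16 * profileNorm c₂ / Λ ^ 3) + wk₂)) *
          (11 * (Hc₃ * (Mv₃ * S₃)) + (Hc₃ * Mv₃ * (12 * (1 + Λ) * S₃ / X₃ + 16 * profileNorm c₃ / Λ ^ 3) + wk₃)) -
          11 * (Hc₁ * (Mv₁ * S₁)) * (11 * (Hc₂ * (Mv₂ * S₂))) * (11 * (Hc₃ * (Mv₃ * S₃))) ≤
        (1 + Hc₁) * (1 + Hc₂) * (1 + Hc₃) * C₁ + Hc₁ * Hc₂ * Hc₃ * C₂ := by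
      have h := flat_level_le hHc₁0 hHc₂0 hHc₃0 hMv₁ hMv₂ hMv₃ hS₁ hS₂ hS₃
        (by positivity : (0 : ℝ) ≤ 12 * (1 + Λ) * S₁ / X₁ + 16 * profileNorm c₁ / Λ ^ 3)
        (by positivity : (0 : ℝ) ≤ 12 * (1 + Λ) * S₂ / X₂ + 16 * profileNorm c₂ / Λ ^ 3)
        (by positivity : (0 : ℝ) ≤ 12 * (1 + Λ) * S₃ / X₃ + 16 * profileNorm c₃ / Λ ^ 3)
        hwk₁0 hwk₂0 hwk₃0 hwk₁ hwk₂ hwk₃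
      rwa [← hb₁', ← hb₂', ← hb₃', ← hC₁', ← hC₂'] at h
    have hdX₁ : 0 < (d₁ : ℝ) * X₁ := by positivity
    obtain ⟨hB0, hBA⟩ : 0 < B ∧ B ≤ A := ⟨by rw [hB']; exact lt_min hX₃0 hdX₁, by rw [hA', hB']; exact min_le_max⟩
    obtain ⟨hD0, hFl0⟩ : 0 ≤ D ∧ 0 ≤ Fl := ⟨by rw [hD']; positivity, by rw [hFl']; positivity⟩
    have hpt : ∀ β : ℝ, |β| ≤ ρ → ‖G ((a : ℝ) / k + β) - LFp k a * K β‖ ≤ D * (1 / ((1 + A * |β|) * (1 + B * |β|))) + Fl := by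
      intro β hβ
      have hβx : |β| * x ≤ Λ / 2 := by
        have := mul_le_mul_of_nonneg_right hβ hx0.le
        rw [hρx] at this; linarith
      have h := parity_major_point hx hy hα1' hΛ hη0 hη1 hε₀ hC hWraw hF hσ he₁ he₂ he₃ hex₁ hex₂ hex₃ hΛ₁' hΛ₂' hΛ₃'
        hd₁' hd₂' hk1 hkSm hEk₁ hEk₂ hEk₃ a hc₁ hc₂ hc₃ hβx
      rw [← hα'] at h
      rw [← hX₁', ← hX₂', ← hX₃', ← hM₀', ← hMv₁', ← hMv₂', ← hMv₃', ← hS₁', ← hS₂', ← hS₃'] at h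
      rw [← hHc₁', ← hHc₂', ← hHc₃', ← hwk₁', ← hwk₂', ← hwk₃'] at h
      have h1 : 331 * η * (Hc₁ * (Mv₁ * S₁)) * (Hc₂ * (Mv₂ * S₂)) * (Hc₃ * (Mv₃ * S₃)) *
          (1 / (1 + |(d₁ : ℝ) * β * X₁|) * (1 / (1 + |(d₂ : ℝ) * β * X₂|)) * (1 / (1 + |β * X₃|))) ≤
          D * (1 / ((1 + A * |β|) * (1 + B * |β|))) := by
        rw [hD', hA', hB']
        exact mul_le_mul_of_nonneg_left (decay_three_le_two hX₁0 hX₃0 d₁ d₂) (by positivity)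
      have h2 : 3 * ((11 * (Hc₁ * (Mv₁ * S₁)) + (Hc₁ * Mv₁ * (12 * (1 + Λ) * S₁ / X₁ + 16 * profileNorm c₁ / Λ ^ 3) + wk₁)) *
          (11 * (Hc₂ * (Mv₂ * S₂)) + (Hc₂ * Mv₂ * (12 * (1 + Λ) * S₂ / X₂ + 16 * profileNorm c₂ / Λ ^ 3) + wk₂)) *
          (11 * (Hc₃ * (Mv₃ * S₃)) + (Hc₃ * Mv₃ * (12 * (1 + Λ) * S₃ / X₃ + 16 * profileNorm c₃ / Λ ^ 3) + wk₃)) -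
          11 * (Hc₁ * (Mv₁ * S₁)) * (11 * (Hc₂ * (Mv₂ * S₂))) * (11 * (Hc₃ * (Mv₃ * S₃)))) ≤ Fl := by
        rw [hFl']
        exact mul_le_mul_of_nonneg_left hflat (by norm_num)
      simp only [hG', hK', hLFp']
      exact h.trans (add_le_add h1 h2)
    have hGper : ∀ (θ : ℝ) (n : ℤ), G (θ + n) = G θ := fun θ n => by
      simp only [hG']; exact tripleV_add_int X₁ X₂ X₃ y c₁ c₂ c₃ d₁ d₂ σ θ n
    have hKper : ∀ (u : ℝ) (n : ℤ), K (u + n) = K u := fun u n => by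
      simp only [hK']; exact modelK_add_int c₁ c₂ c₃ Mv₁ Mv₂ Mv₃ X₁ X₂ X₃ α d₁ d₂ σ u n
    have harc := norm_arc_sum_sub_le hN0 k a hρ0.le hB0 hBA hD0 hFl0 hGper hKper hpt
    refine harc.trans ?_
    have hlat : 4 * (1 + (N₀ : ℝ) / A * (3 + |Real.log (B / N₀)|)) ≤ LAT := by
      rw [hLAT', hA', hB']; exact lattice_factor_le hX₁0 hX₃0 hN0r.le hd₁1
    calc D * (4 * (1 + (N₀ : ℝ) / A * (3 + |Real.log (B / N₀)|))) + 4 * (ρ * N₀ + 1) * Fl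
        ≤ D * LAT + 4 * (ρ * N₀ + 1) * Fl := add_le_add (mul_le_mul_of_nonneg_left hlat hD0) le_rfl
      _ = _ := by rw [hD', hFl', hH3ka, hHpka]; ring
  -- ### Step C: the model sums on one arc against `N₀ · parityModelCount`
  have harcK : ∀ k a : ℕ, ‖(∑ r ∈ (Finset.range N₀).filter (fun r : ℕ => distInt ((r : ℝ) / N₀ - (a : ℝ) / k) ≤ ρ), K ((r : ℝ) / N₀ - (a : ℝ) / k)) - (N₀ : ℂ) * MC‖ ≤ P * OFF := by
    intro k a
    have hKb : ∀ u : ℝ, ‖K u‖ ≤ P / ((1 + X₃ * distInt u) * (1 + X₁ * distInt ((d₁ : ℝ) * u))) := fun u => by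
      rw [hK', hP', hS₁', hS₂', hS₃']
      exact norm_modelK_le hc₁ hc₂ hc₃ hMv₁ hMv₂ hMv₃ hX₁ hX₂0 hX₃ hα0.le hα1 d₁ d₂ σ u
    have htot : ∑ r ∈ Finset.range N₀, K ((r : ℝ) / N₀ - (a : ℝ) / k) = (N₀ : ℂ) * MC := by
      have h := parityModel_circle (Nat.pos_iff_ne_zero.mp hN0) hσ hwrap Mv₁ Mv₂ Mv₃ α c₁ c₂ c₃ (-((a : ℝ) / k))
      rw [hMC', hK']
      simpa only [sub_eq_add_neg] using h
    rw [hOFF']; exact norm_arc_sum_sub_total_le hN0 hd₁1 hcop k a hρ0 hρN hX₃0 hX₁0 hP0 hKb htot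
  -- ### Step D: local factors, singular series, model count; collection
  have hLF : ∀ k a : ℕ, ‖LFp k a‖ ≤ H3 k a := fun k a => by
    simp only [hLFp', hH3']; exact norm_LF_triple_le hα0.le k _ _ _
  have hsing : ‖(∑ k ∈ Icc 1 R, ∑ a ∈ (Finset.range k).filter (Nat.Coprime k), LFp k a) - paritySingSeries α σ d₁ d₂‖ ≤ TAILB := by
    have e : ∑ k ∈ Icc 1 R, ∑ a ∈ (Finset.range k).filter (Nat.Coprime k), LFp k a = ∑ k ∈ Icc 1 R, paritySingTerm α σ d₁ d₂ k :=
      Finset.sum_congr rfl fun k _ => by simp only [hLFp']; rfl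
    rw [e, norm_sub_rev, hTAILB']
    exact norm_paritySingSeries_sub_sum_le hα hα1 hσ hd₁0 hd₁e hd₂o R
  have hMCb : ‖MC‖ ≤ (Mv₁ * S₁) * (Mv₂ * S₂) * (Mv₃ * S₃) / X₃ := by
    rw [hMC', hS₁', hS₂', hS₃']
    exact norm_parityModelCount_le' hc₁ hc₂ hc₃ σ d₁ d₂ hX₁0 hX₂0 hX₃0 hMv₁ hMv₂ hMv₃ hα0.le
  set Φ : ℝ := 331 * η * ((Mv₁ * S₁) * (Mv₂ * S₂) * (Mv₃ * S₃)) * LAT + 12 * (ρ * N₀ + 1) * C₂ with hΦ'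
  set Ψ : ℝ := 12 * (ρ * N₀ + 1) * C₁ with hΨ'
  have hterm : ∀ k ∈ Icc 1 R, ∀ a ∈ (Finset.range k).filter (Nat.Coprime k),
      ‖(∑ r ∈ (Finset.range N₀).filter (fun r : ℕ => distInt ((r : ℝ) / N₀ - (a : ℝ) / k) ≤ ρ), G ((r : ℝ) / N₀)) - LFp k a * ((N₀ : ℂ) * MC)‖ ≤ H3 k a * (Φ + P * OFF) + Hp k a * Ψ := by
    intro k hk a ha
    have e : (∑ r ∈ (Finset.range N₀).filter (fun r : ℕ => distInt ((r : ℝ) / N₀ - (a : ℝ) / k) ≤ ρ), G ((r : ℝ) / N₀)) - LFp k a * ((N₀ : ℂ) * MC) =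
        ((∑ r ∈ (Finset.range N₀).filter (fun r : ℕ => distInt ((r : ℝ) / N₀ - (a : ℝ) / k) ≤ ρ), G ((r : ℝ) / N₀)) - LFp k a * ∑ r ∈ (Finset.range N₀).filter (fun r : ℕ => distInt ((r : ℝ) / N₀ - (a : ℝ) / k) ≤ ρ), K ((r : ℝ) / N₀ - (a : ℝ) / k)) +
          LFp k a * ((∑ r ∈ (Finset.range N₀).filter (fun r : ℕ => distInt ((r : ℝ) / N₀ - (a : ℝ) / k) ≤ ρ), K ((r : ℝ) / N₀ - (a : ℝ) / k)) - (N₀ : ℂ) * MC) := by ring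
    rw [e]
    refine (norm_add_le _ _).trans ?_
    rw [norm_mul]
    have h1 := harcG k hk a ha
    have h2 : ‖LFp k a‖ * ‖(∑ r ∈ (Finset.range N₀).filter (fun r : ℕ => distInt ((r : ℝ) / N₀ - (a : ℝ) / k) ≤ ρ), K ((r : ℝ) / N₀ - (a : ℝ) / k)) - (N₀ : ℂ) * MC‖ ≤ H3 k a * (P * OFF) :=
      mul_le_mul (hLF k a) (harcK k a) (norm_nonneg _) (hH3nn k a)
    calc _ ≤ (H3 k a * Φ + Hp k a * Ψ) + H3 k a * (P * OFF) := add_le_add h1 h2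
      _ = _ := by ring
  have hsumU : ‖∑ k ∈ Icc 1 R, ∑ a ∈ (Finset.range k).filter (Nat.Coprime k),
      ((∑ r ∈ (Finset.range N₀).filter (fun r : ℕ => distInt ((r : ℝ) / N₀ - (a : ℝ) / k) ≤ ρ), G ((r : ℝ) / N₀)) - LFp k a * ((N₀ : ℂ) * MC))‖ ≤
      (Φ + P * OFF) * (∑ k ∈ Icc 1 R, ∑ a ∈ (Finset.range k).filter (Nat.Coprime k), H3 k a) +
        Ψ * (∑ k ∈ Icc 1 R, ∑ a ∈ (Finset.range k).filter (Nat.Coprime k), Hp k a) := by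
    refine ((norm_sum_le _ _).trans (Finset.sum_le_sum fun k hk => (norm_sum_le _ _).trans
      (Finset.sum_le_sum fun a ha => hterm k hk a ha))).trans ?_
    rw [Finset.mul_sum, Finset.mul_sum, ← Finset.sum_add_distrib]
    refine le_of_eq (Finset.sum_congr rfl fun k _ => ?_)
    rw [Finset.mul_sum, Finset.mul_sum, ← Finset.sum_add_distrib]
    exact Finset.sum_congr rfl fun a _ => by ring
  have hT : ∑ k ∈ Icc 1 R, ∑ a ∈ (Finset.range k).filter (Nat.Coprime k), LFp k a * ((N₀ : ℂ) * MC) =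
      (∑ k ∈ Icc 1 R, ∑ a ∈ (Finset.range k).filter (Nat.Coprime k), LFp k a) * ((N₀ : ℂ) * MC) := by
    rw [Finset.sum_mul]; exact Finset.sum_congr rfl fun k _ => by rw [Finset.sum_mul]
  have hS : ∑ k ∈ Icc 1 R, ∑ a ∈ (Finset.range k).filter (Nat.Coprime k),
      ((∑ r ∈ (Finset.range N₀).filter (fun r : ℕ => distInt ((r : ℝ) / N₀ - (a : ℝ) / k) ≤ ρ), G ((r : ℝ) / N₀)) - LFp k a * ((N₀ : ℂ) * MC)) =
      (∑ k ∈ Icc 1 R, ∑ a ∈ (Finset.range k).filter (Nat.Coprime k), ∑ r ∈ (Finset.range N₀).filter (fun r : ℕ => distInt ((r : ℝ) / N₀ - (a : ℝ) / k) ≤ ρ), G ((r : ℝ) / N₀)) -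
        ∑ k ∈ Icc 1 R, ∑ a ∈ (Finset.range k).filter (Nat.Coprime k), LFp k a * ((N₀ : ℂ) * MC) := by
    rw [← Finset.sum_sub_distrib]; exact Finset.sum_congr rfl fun k _ => by rw [Finset.sum_sub_distrib]
  have hid : (∑ k ∈ Icc 1 R, ∑ a ∈ (Finset.range k).filter (Nat.Coprime k), ∑ r ∈ (Finset.range N₀).filter (fun r : ℕ => distInt ((r : ℝ) / N₀ - (a : ℝ) / k) ≤ ρ), G ((r : ℝ) / N₀)) -
      (N₀ : ℂ) * paritySingSeries α σ d₁ d₂ * MC =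
      (∑ k ∈ Icc 1 R, ∑ a ∈ (Finset.range k).filter (Nat.Coprime k),
        ((∑ r ∈ (Finset.range N₀).filter (fun r : ℕ => distInt ((r : ℝ) / N₀ - (a : ℝ) / k) ≤ ρ), G ((r : ℝ) / N₀)) - LFp k a * ((N₀ : ℂ) * MC))) +
      ((∑ k ∈ Icc 1 R, ∑ a ∈ (Finset.range k).filter (Nat.Coprime k), LFp k a) - paritySingSeries α σ d₁ d₂) *
        ((N₀ : ℂ) * MC) := by
    rw [hS, hT]; ring
  rw [hid]; refine (norm_add_le _ _).trans ?_; rw [norm_mul, norm_mul, Complex.norm_natCast]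
  have h2 : ‖(∑ k ∈ Icc 1 R, ∑ a ∈ (Finset.range k).filter (Nat.Coprime k), LFp k a) - paritySingSeries α σ d₁ d₂‖ *
      ((N₀ : ℝ) * ‖MC‖) ≤ TAILB * ((N₀ : ℝ) * ((Mv₁ * S₁) * (Mv₂ * S₂) * (Mv₃ * S₃) / X₃)) :=
    mul_le_mul hsing (mul_le_mul_of_nonneg_left hMCb hN0r.le) (by positivity) hTAILB0
  refine (add_le_add hsumU h2).trans (le_of_eq ?_)
  simp only [hΦ', hΨ', hP', hH3', hHp']
  ring

end SmoothArcs

end Literature.NumberTheory.Sieve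

end
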